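import Summits.QuantumFields.YangMills.Theorems.UnitScaleTiltProp7CovLinearTowerProfile
import Summits.QuantumFields.YangMills.Theorems.UnitScaleTiltProp7CovKernel148
import Summits.QuantumFields.YangMills.Theorems.UnitScaleTiltProp7CovOrbitSizes
import Summits.QuantumFields.YangMills.Theorems.UnitScaleTiltProp8ChartKernelTower
import HarnessLib

/-!
# Route `UnitScaleTilt`, crux K1 «MinimiserStabilityRegPr» (stmt-QuantumFields-19200), EX display row (157)-twˢ `hC157`, C-ENTRY line, file F-4b (letters) —
# **THE LEVEL LETTERS OF THE KERNEL TOWER AT A CURVED BACKGROUND** (`hE`, `hT` with level-uniform constants, supports, read sums) for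
# [Balaban1985Averaging] PROP. 5 (157): THE PER-BOND KERNEL OF THE DERIVATIVE OF THE COVARIANT LOG-COORDINATE TOWER BEYOND ITS LINEAR PART
# `‖∂_t|₀ F_J(B + tδ)(c) − (Lin_J δ)(c)‖ ≤ C·(2L^J‖B‖)·(2(L·L^{−d})^J‖δ‖)` for the tower of a plaquette-small SU(2) background — the assembly of ✓`ChartKernelTower.kernel_tower_bound_le` +
# ✓`tower_deriv_recursion` (print (149)–(155)) with `hT` = F-2, `hE` = F-3a, sizes = F-3b, `ha`∕`hSa` = F-4a (✓`LeakyLinearTower`), supports by locality.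

Cell `ym3-torus` (HUMAN RULING D-0037: YM₃ on T³ is ladder rung R3, not the Clay problem), width seat `ym3-torus-px18` gen 3; ★w2-19200 g8 «C-ENTRY GO».  `--supports
stmt-QuantumFields-19200 --as helper`; def-free, 0 sorry; count-neutral.

LETTERS.  `PlaqSmall a₀ U₀`, `Ū₀ˡ = emlIterU l U₀♭`, the field-valued one-step charts `f_l`, the iterate `Fm` (✓`Prop7CovLogTower.exists_iterate` letters) and the composed linear parts
`Lin` (✓`exists_lin` letters), budgets VERBATIM from ★routeR-w3∕w6 (`6400ℓ²Lˡs_B ≤ 1`, `10⁷ℓ²ρ ≤ 1`, `4s₀(l) < ρ`, `1000ℓ(2s₀(l)+3R) ≤ 1`), `s₀(l) = 30ℓLˡ·2d(3L^{l+1} − 1)a₀`,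
`c_R(l) = 16(12Lρ)∕ρ²·2s₀(l)`, `B_l = L·3R + 22100ℓ²(s₀(l)+(s₀(l)+3R))²`; `λ := L·(Lᵈ)⁻¹`; numeric letters `θ₀ ≥ 2λ + c_R(J−1)`, `G ≥ 64B_{J−1}/R²`,
`A′ := G·2d∕(L·λ)`, `θ := θ₀∕(L·λ)`, `δ′ := A′·(2L^J‖B‖)`, window `θ + δ′ < 1`.
§1 `s0_mono`, `supports_iterate_const` (the orbit component off the readers does not move: locality ✓`chart_congr`).
§2 ★★★ `hasDerivAt_iterate_kernel_bound_of_plaqSmall` — `3 ≤ L`, `J + 1 ≤ m_P + K_P`, the budgets (`l < J`), `8L^J‖B‖ ≤ R`, F-3b's two summability windows, F-4a's window, the kernel window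
`θ + δ′ < 1`; `δ` vanishing off the fine bond `b₀`.  Then there is `vd` with `HasDerivAt (t ↦ Fm J (B + t•δ)) vd 0` and
**`‖vd(c) − (Lin J δ)(c)‖ ≤ A′/(1 − θ − δ′)·(2L^J‖B‖)·(2λ^J‖δ‖)` for every level-`J` bond `c`** — print's `|δC_k∕δA_b| ≤ C₃|A|` with the tube scale, at a CURVED background
(in d = 3: `L^J·L^{−2J} = L^{−J}` = the `(L^{K−n})⁻¹` of `hC157`).
HONEST SCOPE.  Assembly of landed∕pending bricks; constants crude and DISPLAYED; the T³ reading (`CmapTwS = Fm − Lin` at the top by ✓`CmapTwS_apply_eq_iterate_sub_lin`, `RegPr ⇒ PlaqSmall`,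
numerals) ⇒ `hC157` is the NEXT file (F-5); nothing of `hC157`, EX, E′ or the crux is claimed here; rung R3, not d = 4; YM gap NOT proved.

References: T. Bałaban, CMP **98** (1985) 17–51 [Balaban1985Averaging] ((87)–(92) p.31, (124)–(127) p.36, (139)–(157) pp.39–42, (161)–(163) p.42).
-/

noncomputable section

open scoped BigOperators Matrix.Norms.L2Operator
open NormedSpace Metric Set Finset Filter Topology

namespace Summit.QuantumFields.YangMills.Theorems.Prop7CovKernelTowerLetters

open Literature.MathematicalPhysics.QuantumFieldTheory.Balaban1983to89
open T4Continuum BlockAveraging AveragingRT ExpMeanLog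
open B5Eq118OneStroke (iterBlockOf iterBlockOf_succ iterBlockOf_zero)
open B15DeterminingSets (embIter)
open B7Prop1Explicit (expUnit val_expUnit U1 mem_U1)
open MatrixLog (mlog)
open B10Eq27TorusAxialLog (axialT gaugeActT gaugeActT_apply unitsField toUField suIncl)
open Summit.QuantumFields.YangMills.Theorems.Prop8Chart (emlAvgU emlIterU)
open Summit.QuantumFields.YangMills.Theorems.Prop7SymAvgTwSym (dbarCovU)
open Summit.QuantumFields.YangMills.Theorems.Prop7TwistedOneStepDefectCov (chart_congr)
open Summit.QuantumFields.YangMills.Theorems.Prop7CovKernelOneStep (norm_fderiv_chartField_apply_le_of_endpoint_of_plaqSmall)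
open Summit.QuantumFields.YangMills.Theorems.Prop7CovKernel148 (differentiableAt_chart_of_plaqSmall norm_fderiv_chart_sub_fderiv_zero_le_of_plaqSmall)
open Summit.QuantumFields.YangMills.Theorems.Prop7CovOrbitSizes (norm_iterate_le_of_plaqSmall)
open Summit.QuantumFields.YangMills.Theorems.Prop7CovLinearTowerProfile (norm_lin_apply_le_of_plaqSmall reads_of_endpoint s0_mul_pow_le)
open Summit.QuantumFields.YangMills.Theorems.ChartKernelTower (kernel_tower_bound_le tower_deriv_recursion sum_norm_le_of_vanish)
open Summit.QuantumFields.YangMills.Theorems.ChartKernelTube (card_le_two_mul_d_of_endpoint)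

variable {P : Params}

/-! ## §1 Monotonicity of the leak, constancy of the orbit off the readers, read sums against support sums -/

/-- `s₀(m) ≤ s₀(J−1)` for `m < J` (`1 ≤ L`, `0 ≤ a₀`; ✓`s0_mul_pow_le` and `(L²)ⁿ ≥ 1`). [cite: Balaban1985Averaging, (52) p.25] -/
theorem s0_mono (hL1 : (1 : ℝ) ≤ P.L) {a₀ : ℝ} (ha₀ : 0 ≤ a₀) {m J : ℕ} (hm : m < J) :
    (30 * (((P.d + 2) * P.L : ℕ) : ℝ) * (P.L : ℝ) ^ m * (2 * ((P.d : ℝ) * (3 * (P.L : ℝ) ^ (m + 1) - 1)) * a₀)) ≤ (30 * (((P.d + 2) * P.L : ℕ) : ℝ) * (P.L : ℝ) ^ (J - 1) * (2 * ((P.d : ℝ) * (3 * (P.L : ℝ) ^ ((J - 1) + 1) - 1)) * a₀)) := by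
  have h := s0_mul_pow_le (P := P) hL1 ha₀ m (J - 1 - m)
  rw [show m + (J - 1 - m) = J - 1 by omega] at h
  have hX : (1 : ℝ) ≤ ((P.L : ℝ) ^ 2) ^ (J - 1 - m) := one_le_pow₀ (by nlinarith)
  have h0 : 0 ≤ (30 * (((P.d + 2) * P.L : ℕ) : ℝ) * (P.L : ℝ) ^ m * (2 * ((P.d : ℝ) * (3 * (P.L : ℝ) ^ (m + 1) - 1)) * a₀)) := by
    have h3 : (0 : ℝ) ≤ 3 * (P.L : ℝ) ^ (m + 1) - 1 := by linarith [one_le_pow₀ (n := m + 1) hL1]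
    positivity
  nlinarith

/-- **THE ORBIT DOES NOT MOVE OFF THE READERS**: for the iterate `Fm` (`Fm 0 x = x`, `Fm (l+1) x = f_l(Fm l x)`), `δ` vanishing off `b₀`, every `m ≤ m_P + K_P`, every `t`, and every
level-`m` bond `c` not having `x̄_m = iterBlockOf m (b₀)₋` as an endpoint: `Fm m (B + t•δ)(c) = Fm m B (c)` (induction on `m`, ✓`chart_congr`). [cite: Balaban1985Averaging, (87)–(92) p.31] -/
theorem supports_iterate_const (U₀ : GaugeField P 0 (Matrix.specialUnitaryGroup (Fin 2) ℂ))
    (Fm : (m : ℕ) → (PBond P 0 → Matrix (Fin 2) (Fin 2) ℂ) → (PBond P m → Matrix (Fin 2) (Fin 2) ℂ)) (hF0 : ∀ x, Fm 0 x = x)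
    (hFs : ∀ (l : ℕ) (x : PBond P 0 → Matrix (Fin 2) (Fin 2) ℂ), Fm (l + 1) x = (fun (y : PBond P l → Matrix (Fin 2) (Fin 2) ℂ) (c : PBond P (l + 1)) =>
          mlog (((dbarCovU (emlIterU l (unitsField (toUField U₀))) (fun b => expUnit (y b) * emlIterU l (unitsField (toUField U₀)) b) c :
              (Matrix (Fin 2) (Fin 2) ℂ)ˣ) : Matrix (Fin 2) (Fin 2) ℂ) *
            (((emlAvgU (emlIterU l (unitsField (toUField U₀))) c)⁻¹ : (Matrix (Fin 2) (Fin 2) ℂ)ˣ) : Matrix (Fin 2) (Fin 2) ℂ))) (Fm l x))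
    (B : PBond P 0 → Matrix (Fin 2) (Fin 2) ℂ) (b₀ : PBond P 0) (δ : PBond P 0 → Matrix (Fin 2) (Fin 2) ℂ) (hδ : ∀ b, b ≠ b₀ → δ b = 0) (t : ℂ) :
    ∀ m, m ≤ P.m + P.K → ∀ c : PBond P m, ¬ (c.src = iterBlockOf m b₀.src ∨ c.tgt = iterBlockOf m b₀.src) → Fm m (B + t • δ) c = Fm m B c := by
  intro m
  induction m with
  | zero =>
    intro _ c hc
    rw [hF0, hF0, Pi.add_apply, Pi.smul_apply]
    have hcb : c ≠ b₀ := fun h => hc (Or.inl (by rw [h, iterBlockOf_zero]))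
    rw [hδ c hcb, smul_zero, add_zero]
  | succ m ih =>
    intro hm c hc
    rw [hFs m, hFs m]
    exact chart_congr (by omega) _ c fun b h1 h2 => ih (by omega) b fun hb => hc (by
      rw [iterBlockOf_succ]; exact reads_of_endpoint c b _ hb h1 h2)

/-! ## §2 The `hE` and `hT` letters of the abstract induction, at level `m` -/

/-- **THE `hE` LETTER, FIELD-VALUED**: at a point `x` with `‖x‖ ≤ s`, `0 ≤ s < R/8`, for `w` vanishing off `S` and `G ≥ 64B_m/R²`:
`‖(D(f_m − Df_m(0))(x)[w])(c)‖ ≤ G·s·Σ_{c′ ∈ S} ‖w c′‖` (F-3a ✓`norm_fderiv_chart_sub_fderiv_zero_le_of_plaqSmall`, component extraction, read sum ≤ support sum).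
[cite: Balaban1985Averaging, (148) p.40, (152) p.40] -/
theorem norm_fderiv_rem_apply_le_of_plaqSmall {m : ℕ} (hm2 : m + 2 ≤ P.m + P.K)
    (U₀ : GaugeField P 0 (Matrix.specialUnitaryGroup (Fin 2) ℂ)) {a₀ : ℝ} (ha₀ : 0 < a₀) (hU : PlaqSmall a₀ U₀)
    (hbud₀ : 6400 * (((P.d + 2) * P.L : ℕ) : ℝ) ^ 2 * (P.L : ℝ) ^ m * (2 * ((P.d : ℝ) * (3 * (P.L : ℝ) ^ (m + 1) - 1)) * a₀) ≤ 1)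
    {R s : ℝ} (hR : 0 < R) (hs0 : 0 ≤ s) (hs : s < R / 8) (hwin : 1000 * (((P.d + 2) * P.L : ℕ) : ℝ) * (2 * (30 * (((P.d + 2) * P.L : ℕ) : ℝ) * (P.L : ℝ) ^ m * (2 * ((P.d : ℝ) * (3 * (P.L : ℝ) ^ (m + 1) - 1)) * a₀)) + 3 * R) ≤ 1)
    {G : ℝ} (hGB : 64 * ((P.L : ℝ) * (3 * R) + 22100 * (((P.d + 2) * P.L : ℕ) : ℝ) ^ 2 * ((30 * (((P.d + 2) * P.L : ℕ) : ℝ) * (P.L : ℝ) ^ m * (2 * ((P.d : ℝ) * (3 * (P.L : ℝ) ^ (m + 1) - 1)) * a₀)) + ((30 * (((P.d + 2) * P.L : ℕ) : ℝ) * (P.L : ℝ) ^ m * (2 * ((P.d : ℝ) * (3 * (P.L : ℝ) ^ (m + 1) - 1)) * a₀)) + 3 * R)) ^ 2) / R ^ 2 ≤ G)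
    {x : PBond P m → Matrix (Fin 2) (Fin 2) ℂ} (hx : ‖x‖ ≤ s) (S : Finset (PBond P m)) (w : PBond P m → Matrix (Fin 2) (Fin 2) ℂ) (hw : ∀ c', c' ∉ S → w c' = 0) (c : PBond P (m + 1)) :
    ‖fderiv ℂ (fun W => (fun (y : PBond P m → Matrix (Fin 2) (Fin 2) ℂ) (c : PBond P (m + 1)) =>
          mlog (((dbarCovU (emlIterU m (unitsField (toUField U₀))) (fun b => expUnit (y b) * emlIterU m (unitsField (toUField U₀)) b) c :
              (Matrix (Fin 2) (Fin 2) ℂ)ˣ) : Matrix (Fin 2) (Fin 2) ℂ) *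
            (((emlAvgU (emlIterU m (unitsField (toUField U₀))) c)⁻¹ : (Matrix (Fin 2) (Fin 2) ℂ)ˣ) : Matrix (Fin 2) (Fin 2) ℂ))) W - (fderiv ℂ (fun (y : PBond P m → Matrix (Fin 2) (Fin 2) ℂ) (c : PBond P (m + 1)) =>
          mlog (((dbarCovU (emlIterU m (unitsField (toUField U₀))) (fun b => expUnit (y b) * emlIterU m (unitsField (toUField U₀)) b) c :
              (Matrix (Fin 2) (Fin 2) ℂ)ˣ) : Matrix (Fin 2) (Fin 2) ℂ) *
            (((emlAvgU (emlIterU m (unitsField (toUField U₀))) c)⁻¹ : (Matrix (Fin 2) (Fin 2) ℂ)ˣ) : Matrix (Fin 2) (Fin 2) ℂ))) 0) W) x w c‖ ≤ G * s * ∑ c' ∈ S, ‖w c'‖ := by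
  classical
  have hL1 : (1 : ℝ) ≤ P.L := by exact_mod_cast P.L_pos
  have hs₀0 : 0 ≤ (30 * (((P.d + 2) * P.L : ℕ) : ℝ) * (P.L : ℝ) ^ m * (2 * ((P.d : ℝ) * (3 * (P.L : ℝ) ^ (m + 1) - 1)) * a₀)) := by
    have h3 : (0 : ℝ) ≤ 3 * (P.L : ℝ) ^ (m + 1) - 1 := by linarith [one_le_pow₀ (n := m + 1) hL1]
    have ha := ha₀.le
    positivity
  have hxR : ‖x‖ < R := by linarith
  have hcd : ∀ (z : PBond P m → Matrix (Fin 2) (Fin 2) ℂ), ‖z‖ < R → ∀ c' : PBond P (m + 1), DifferentiableAt ℂ (fun (y : PBond P m → Matrix (Fin 2) (Fin 2) ℂ) =>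
          mlog (((dbarCovU (emlIterU m (unitsField (toUField U₀))) (fun b => expUnit (y b) * emlIterU m (unitsField (toUField U₀)) b) c' :
              (Matrix (Fin 2) (Fin 2) ℂ)ˣ) : Matrix (Fin 2) (Fin 2) ℂ) *
            (((emlAvgU (emlIterU m (unitsField (toUField U₀))) c')⁻¹ : (Matrix (Fin 2) (Fin 2) ℂ)ˣ) : Matrix (Fin 2) (Fin 2) ℂ))) z :=
    fun z hz c' => differentiableAt_chart_of_plaqSmall hm2 U₀ ha₀ hU hbud₀ hwin c' hz
  have hdF : ∀ (z : PBond P m → Matrix (Fin 2) (Fin 2) ℂ), ‖z‖ < R → DifferentiableAt ℂ (fun (y : PBond P m → Matrix (Fin 2) (Fin 2) ℂ) (c : PBond P (m + 1)) =>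
          mlog (((dbarCovU (emlIterU m (unitsField (toUField U₀))) (fun b => expUnit (y b) * emlIterU m (unitsField (toUField U₀)) b) c :
              (Matrix (Fin 2) (Fin 2) ℂ)ˣ) : Matrix (Fin 2) (Fin 2) ℂ) *
            (((emlAvgU (emlIterU m (unitsField (toUField U₀))) c)⁻¹ : (Matrix (Fin 2) (Fin 2) ℂ)ˣ) : Matrix (Fin 2) (Fin 2) ℂ))) z := fun z hz => differentiableAt_pi.2 (hcd z hz)
  have hx0 : ‖(0 : PBond P m → Matrix (Fin 2) (Fin 2) ℂ)‖ < R := by rw [norm_zero]; exact hR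
  have hf : DifferentiableAt ℂ (fun W => (fun (y : PBond P m → Matrix (Fin 2) (Fin 2) ℂ) (c : PBond P (m + 1)) =>
          mlog (((dbarCovU (emlIterU m (unitsField (toUField U₀))) (fun b => expUnit (y b) * emlIterU m (unitsField (toUField U₀)) b) c :
              (Matrix (Fin 2) (Fin 2) ℂ)ˣ) : Matrix (Fin 2) (Fin 2) ℂ) *
            (((emlAvgU (emlIterU m (unitsField (toUField U₀))) c)⁻¹ : (Matrix (Fin 2) (Fin 2) ℂ)ˣ) : Matrix (Fin 2) (Fin 2) ℂ))) W - (fderiv ℂ (fun (y : PBond P m → Matrix (Fin 2) (Fin 2) ℂ) (c : PBond P (m + 1)) =>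
          mlog (((dbarCovU (emlIterU m (unitsField (toUField U₀))) (fun b => expUnit (y b) * emlIterU m (unitsField (toUField U₀)) b) c :
              (Matrix (Fin 2) (Fin 2) ℂ)ˣ) : Matrix (Fin 2) (Fin 2) ℂ) *
            (((emlAvgU (emlIterU m (unitsField (toUField U₀))) c)⁻¹ : (Matrix (Fin 2) (Fin 2) ℂ)ˣ) : Matrix (Fin 2) (Fin 2) ℂ))) 0) W) x := (hdF x hxR).sub (fderiv ℂ (fun (y : PBond P m → Matrix (Fin 2) (Fin 2) ℂ) (c : PBond P (m + 1)) =>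
          mlog (((dbarCovU (emlIterU m (unitsField (toUField U₀))) (fun b => expUnit (y b) * emlIterU m (unitsField (toUField U₀)) b) c :
              (Matrix (Fin 2) (Fin 2) ℂ)ˣ) : Matrix (Fin 2) (Fin 2) ℂ) *
            (((emlAvgU (emlIterU m (unitsField (toUField U₀))) c)⁻¹ : (Matrix (Fin 2) (Fin 2) ℂ)ˣ) : Matrix (Fin 2) (Fin 2) ℂ))) 0).differentiableAt
  have hcomp : fderiv ℂ (fun W => (fun (y : PBond P m → Matrix (Fin 2) (Fin 2) ℂ) (c : PBond P (m + 1)) =>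
          mlog (((dbarCovU (emlIterU m (unitsField (toUField U₀))) (fun b => expUnit (y b) * emlIterU m (unitsField (toUField U₀)) b) c :
              (Matrix (Fin 2) (Fin 2) ℂ)ˣ) : Matrix (Fin 2) (Fin 2) ℂ) *
            (((emlAvgU (emlIterU m (unitsField (toUField U₀))) c)⁻¹ : (Matrix (Fin 2) (Fin 2) ℂ)ˣ) : Matrix (Fin 2) (Fin 2) ℂ))) W - (fderiv ℂ (fun (y : PBond P m → Matrix (Fin 2) (Fin 2) ℂ) (c : PBond P (m + 1)) =>
          mlog (((dbarCovU (emlIterU m (unitsField (toUField U₀))) (fun b => expUnit (y b) * emlIterU m (unitsField (toUField U₀)) b) c :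
              (Matrix (Fin 2) (Fin 2) ℂ)ˣ) : Matrix (Fin 2) (Fin 2) ℂ) *
            (((emlAvgU (emlIterU m (unitsField (toUField U₀))) c)⁻¹ : (Matrix (Fin 2) (Fin 2) ℂ)ˣ) : Matrix (Fin 2) (Fin 2) ℂ))) 0) W) x w c =
      fderiv ℂ (fun W => ((fun (y : PBond P m → Matrix (Fin 2) (Fin 2) ℂ) (c : PBond P (m + 1)) =>
          mlog (((dbarCovU (emlIterU m (unitsField (toUField U₀))) (fun b => expUnit (y b) * emlIterU m (unitsField (toUField U₀)) b) c :
              (Matrix (Fin 2) (Fin 2) ℂ)ˣ) : Matrix (Fin 2) (Fin 2) ℂ) *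
            (((emlAvgU (emlIterU m (unitsField (toUField U₀))) c)⁻¹ : (Matrix (Fin 2) (Fin 2) ℂ)ˣ) : Matrix (Fin 2) (Fin 2) ℂ))) W - (fderiv ℂ (fun (y : PBond P m → Matrix (Fin 2) (Fin 2) ℂ) (c : PBond P (m + 1)) =>
          mlog (((dbarCovU (emlIterU m (unitsField (toUField U₀))) (fun b => expUnit (y b) * emlIterU m (unitsField (toUField U₀)) b) c :
              (Matrix (Fin 2) (Fin 2) ℂ)ˣ) : Matrix (Fin 2) (Fin 2) ℂ) *
            (((emlAvgU (emlIterU m (unitsField (toUField U₀))) c)⁻¹ : (Matrix (Fin 2) (Fin 2) ℂ)ˣ) : Matrix (Fin 2) (Fin 2) ℂ))) 0) W) c) x w := by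
    rw [((hasFDerivAt_pi'.mp hf.hasFDerivAt) c).fderiv, ContinuousLinearMap.comp_apply, ContinuousLinearMap.proj_apply]
  rw [hcomp]
  have hpi : ∀ (z : PBond P m → Matrix (Fin 2) (Fin 2) ℂ), ‖z‖ < R → ∀ w' : PBond P m → Matrix (Fin 2) (Fin 2) ℂ, (fderiv ℂ (fun (y : PBond P m → Matrix (Fin 2) (Fin 2) ℂ) (c : PBond P (m + 1)) =>
          mlog (((dbarCovU (emlIterU m (unitsField (toUField U₀))) (fun b => expUnit (y b) * emlIterU m (unitsField (toUField U₀)) b) c :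
              (Matrix (Fin 2) (Fin 2) ℂ)ˣ) : Matrix (Fin 2) (Fin 2) ℂ) *
            (((emlAvgU (emlIterU m (unitsField (toUField U₀))) c)⁻¹ : (Matrix (Fin 2) (Fin 2) ℂ)ˣ) : Matrix (Fin 2) (Fin 2) ℂ))) z w') c = fderiv ℂ (fun (y : PBond P m → Matrix (Fin 2) (Fin 2) ℂ) =>
          mlog (((dbarCovU (emlIterU m (unitsField (toUField U₀))) (fun b => expUnit (y b) * emlIterU m (unitsField (toUField U₀)) b) c :
              (Matrix (Fin 2) (Fin 2) ℂ)ˣ) : Matrix (Fin 2) (Fin 2) ℂ) *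
            (((emlAvgU (emlIterU m (unitsField (toUField U₀))) c)⁻¹ : (Matrix (Fin 2) (Fin 2) ℂ)ˣ) : Matrix (Fin 2) (Fin 2) ℂ))) z w' := by
    intro z hz w'
    rw [fderiv_pi (hcd z hz)]
    simp only [ContinuousLinearMap.pi_apply]
  have hfun : (fun W : PBond P m → Matrix (Fin 2) (Fin 2) ℂ => ((fun (y : PBond P m → Matrix (Fin 2) (Fin 2) ℂ) (c : PBond P (m + 1)) =>
          mlog (((dbarCovU (emlIterU m (unitsField (toUField U₀))) (fun b => expUnit (y b) * emlIterU m (unitsField (toUField U₀)) b) c :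
              (Matrix (Fin 2) (Fin 2) ℂ)ˣ) : Matrix (Fin 2) (Fin 2) ℂ) *
            (((emlAvgU (emlIterU m (unitsField (toUField U₀))) c)⁻¹ : (Matrix (Fin 2) (Fin 2) ℂ)ˣ) : Matrix (Fin 2) (Fin 2) ℂ))) W - (fderiv ℂ (fun (y : PBond P m → Matrix (Fin 2) (Fin 2) ℂ) (c : PBond P (m + 1)) =>
          mlog (((dbarCovU (emlIterU m (unitsField (toUField U₀))) (fun b => expUnit (y b) * emlIterU m (unitsField (toUField U₀)) b) c :
              (Matrix (Fin 2) (Fin 2) ℂ)ˣ) : Matrix (Fin 2) (Fin 2) ℂ) *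
            (((emlAvgU (emlIterU m (unitsField (toUField U₀))) c)⁻¹ : (Matrix (Fin 2) (Fin 2) ℂ)ˣ) : Matrix (Fin 2) (Fin 2) ℂ))) 0) W) c) =
      fun W => (fun (y : PBond P m → Matrix (Fin 2) (Fin 2) ℂ) =>
          mlog (((dbarCovU (emlIterU m (unitsField (toUField U₀))) (fun b => expUnit (y b) * emlIterU m (unitsField (toUField U₀)) b) c :
              (Matrix (Fin 2) (Fin 2) ℂ)ˣ) : Matrix (Fin 2) (Fin 2) ℂ) *
            (((emlAvgU (emlIterU m (unitsField (toUField U₀))) c)⁻¹ : (Matrix (Fin 2) (Fin 2) ℂ)ˣ) : Matrix (Fin 2) (Fin 2) ℂ))) W - fderiv ℂ (fun (y : PBond P m → Matrix (Fin 2) (Fin 2) ℂ) =>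
          mlog (((dbarCovU (emlIterU m (unitsField (toUField U₀))) (fun b => expUnit (y b) * emlIterU m (unitsField (toUField U₀)) b) c :
              (Matrix (Fin 2) (Fin 2) ℂ)ˣ) : Matrix (Fin 2) (Fin 2) ℂ) *
            (((emlAvgU (emlIterU m (unitsField (toUField U₀))) c)⁻¹ : (Matrix (Fin 2) (Fin 2) ℂ)ˣ) : Matrix (Fin 2) (Fin 2) ℂ))) 0 W := by
    funext W
    rw [Pi.sub_apply, hpi 0 hx0 W]
  rw [hfun]
  have hdW : DifferentiableAt ℂ (fun (y : PBond P m → Matrix (Fin 2) (Fin 2) ℂ) =>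
          mlog (((dbarCovU (emlIterU m (unitsField (toUField U₀))) (fun b => expUnit (y b) * emlIterU m (unitsField (toUField U₀)) b) c :
              (Matrix (Fin 2) (Fin 2) ℂ)ˣ) : Matrix (Fin 2) (Fin 2) ℂ) *
            (((emlAvgU (emlIterU m (unitsField (toUField U₀))) c)⁻¹ : (Matrix (Fin 2) (Fin 2) ℂ)ˣ) : Matrix (Fin 2) (Fin 2) ℂ))) x := hcd _ hxR c
  have hh : HasFDerivAt (fun W : PBond P m → Matrix (Fin 2) (Fin 2) ℂ => (fun (y : PBond P m → Matrix (Fin 2) (Fin 2) ℂ) =>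
          mlog (((dbarCovU (emlIterU m (unitsField (toUField U₀))) (fun b => expUnit (y b) * emlIterU m (unitsField (toUField U₀)) b) c :
              (Matrix (Fin 2) (Fin 2) ℂ)ˣ) : Matrix (Fin 2) (Fin 2) ℂ) *
            (((emlAvgU (emlIterU m (unitsField (toUField U₀))) c)⁻¹ : (Matrix (Fin 2) (Fin 2) ℂ)ˣ) : Matrix (Fin 2) (Fin 2) ℂ))) W - fderiv ℂ (fun (y : PBond P m → Matrix (Fin 2) (Fin 2) ℂ) =>
          mlog (((dbarCovU (emlIterU m (unitsField (toUField U₀))) (fun b => expUnit (y b) * emlIterU m (unitsField (toUField U₀)) b) c :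
              (Matrix (Fin 2) (Fin 2) ℂ)ˣ) : Matrix (Fin 2) (Fin 2) ℂ) *
            (((emlAvgU (emlIterU m (unitsField (toUField U₀))) c)⁻¹ : (Matrix (Fin 2) (Fin 2) ℂ)ˣ) : Matrix (Fin 2) (Fin 2) ℂ))) 0 W)
      (fderiv ℂ (fun (y : PBond P m → Matrix (Fin 2) (Fin 2) ℂ) =>
          mlog (((dbarCovU (emlIterU m (unitsField (toUField U₀))) (fun b => expUnit (y b) * emlIterU m (unitsField (toUField U₀)) b) c :
              (Matrix (Fin 2) (Fin 2) ℂ)ˣ) : Matrix (Fin 2) (Fin 2) ℂ) *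
            (((emlAvgU (emlIterU m (unitsField (toUField U₀))) c)⁻¹ : (Matrix (Fin 2) (Fin 2) ℂ)ˣ) : Matrix (Fin 2) (Fin 2) ℂ))) x - fderiv ℂ (fun (y : PBond P m → Matrix (Fin 2) (Fin 2) ℂ) =>
          mlog (((dbarCovU (emlIterU m (unitsField (toUField U₀))) (fun b => expUnit (y b) * emlIterU m (unitsField (toUField U₀)) b) c :
              (Matrix (Fin 2) (Fin 2) ℂ)ˣ) : Matrix (Fin 2) (Fin 2) ℂ) *
            (((emlAvgU (emlIterU m (unitsField (toUField U₀))) c)⁻¹ : (Matrix (Fin 2) (Fin 2) ℂ)ˣ) : Matrix (Fin 2) (Fin 2) ℂ))) 0) x :=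
    hdW.hasFDerivAt.sub (fderiv ℂ (fun (y : PBond P m → Matrix (Fin 2) (Fin 2) ℂ) =>
          mlog (((dbarCovU (emlIterU m (unitsField (toUField U₀))) (fun b => expUnit (y b) * emlIterU m (unitsField (toUField U₀)) b) c :
              (Matrix (Fin 2) (Fin 2) ℂ)ˣ) : Matrix (Fin 2) (Fin 2) ℂ) *
            (((emlAvgU (emlIterU m (unitsField (toUField U₀))) c)⁻¹ : (Matrix (Fin 2) (Fin 2) ℂ)ˣ) : Matrix (Fin 2) (Fin 2) ℂ))) 0).hasFDerivAt
  rw [hh.fderiv]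
  show ‖fderiv ℂ (fun (y : PBond P m → Matrix (Fin 2) (Fin 2) ℂ) =>
          mlog (((dbarCovU (emlIterU m (unitsField (toUField U₀))) (fun b => expUnit (y b) * emlIterU m (unitsField (toUField U₀)) b) c :
              (Matrix (Fin 2) (Fin 2) ℂ)ˣ) : Matrix (Fin 2) (Fin 2) ℂ) *
            (((emlAvgU (emlIterU m (unitsField (toUField U₀))) c)⁻¹ : (Matrix (Fin 2) (Fin 2) ℂ)ˣ) : Matrix (Fin 2) (Fin 2) ℂ))) x w - fderiv ℂ (fun (y : PBond P m → Matrix (Fin 2) (Fin 2) ℂ) =>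
          mlog (((dbarCovU (emlIterU m (unitsField (toUField U₀))) (fun b => expUnit (y b) * emlIterU m (unitsField (toUField U₀)) b) c :
              (Matrix (Fin 2) (Fin 2) ℂ)ˣ) : Matrix (Fin 2) (Fin 2) ℂ) *
            (((emlAvgU (emlIterU m (unitsField (toUField U₀))) c)⁻¹ : (Matrix (Fin 2) (Fin 2) ℂ)ˣ) : Matrix (Fin 2) (Fin 2) ℂ))) 0 w‖ ≤ _
  have h148 := norm_fderiv_chart_sub_fderiv_zero_le_of_plaqSmall hm2 U₀ ha₀ hU hR hs0 hs hbud₀ hwin c hx w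
  refine h148.trans ?_
  have hsum := sum_norm_le_of_vanish S
    (univ.filter fun b : PBond P m => (blockOf b.src = c.src ∨ blockOf b.src = c.tgt) ∧ (blockOf b.tgt = c.src ∨ blockOf b.tgt = c.tgt)) w hw
  have hsum0 : 0 ≤ ∑ b ∈ S, ‖w b‖ := Finset.sum_nonneg fun _ _ => norm_nonneg _
  calc 64 * ((P.L : ℝ) * (3 * R) + 22100 * (((P.d + 2) * P.L : ℕ) : ℝ) ^ 2 * ((30 * (((P.d + 2) * P.L : ℕ) : ℝ) * (P.L : ℝ) ^ m * (2 * ((P.d : ℝ) * (3 * (P.L : ℝ) ^ (m + 1) - 1)) * a₀)) + ((30 * (((P.d + 2) * P.L : ℕ) : ℝ) * (P.L : ℝ) ^ m * (2 * ((P.d : ℝ) * (3 * (P.L : ℝ) ^ (m + 1) - 1)) * a₀)) + 3 * R)) ^ 2) / R ^ 2 * s *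
        ∑ b ∈ (univ.filter fun b : PBond P m => (blockOf b.src = c.src ∨ blockOf b.src = c.tgt) ∧ (blockOf b.tgt = c.src ∨ blockOf b.tgt = c.tgt)), ‖w b‖
      ≤ 64 * ((P.L : ℝ) * (3 * R) + 22100 * (((P.d + 2) * P.L : ℕ) : ℝ) ^ 2 * ((30 * (((P.d + 2) * P.L : ℕ) : ℝ) * (P.L : ℝ) ^ m * (2 * ((P.d : ℝ) * (3 * (P.L : ℝ) ^ (m + 1) - 1)) * a₀)) + ((30 * (((P.d + 2) * P.L : ℕ) : ℝ) * (P.L : ℝ) ^ m * (2 * ((P.d : ℝ) * (3 * (P.L : ℝ) ^ (m + 1) - 1)) * a₀)) + 3 * R)) ^ 2) / R ^ 2 * s * ∑ b ∈ S, ‖w b‖ := mul_le_mul_of_nonneg_left hsum (mul_nonneg (by positivity) hs0)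
    _ ≤ G * s * ∑ b ∈ S, ‖w b‖ := mul_le_mul_of_nonneg_right (mul_le_mul_of_nonneg_right hGB hs0) hsum0

/-- **THE `hT` LETTER WITH A LEVEL-UNIFORM `θ₀`**: for `m < J`, `θ₀ ≥ 2λ + c_R(J−1)`, `w` vanishing off a set `S` of readers of one site and `≤ β′` there:
`‖(Df_m(0)w)(c)‖ ≤ θ₀·β′` (F-2 ✓`norm_fderiv_chartField_apply_le_of_endpoint_of_plaqSmall`, `c_R(m) ≤ c_R(J−1)` ✓`s0_mono`). [cite: Balaban1985Averaging, (139)-(142) p.39, (154) p.41] -/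
theorem norm_fderiv_apply_le_theta_of_plaqSmall {m J : ℕ} (hm : m < J) (hm2 : m + 2 ≤ P.m + P.K)
    (U₀ : GaugeField P 0 (Matrix.specialUnitaryGroup (Fin 2) ℂ)) {a₀ : ℝ} (ha₀ : 0 < a₀) (hU : PlaqSmall a₀ U₀)
    (hbud₀ : 6400 * (((P.d + 2) * P.L : ℕ) : ℝ) ^ 2 * (P.L : ℝ) ^ m * (2 * ((P.d : ℝ) * (3 * (P.L : ℝ) ^ (m + 1) - 1)) * a₀) ≤ 1)
    {ρ : ℝ} (hρ0 : 0 < ρ) (hbudget : 10000000 * (((P.d + 2) * P.L : ℕ) : ℝ) ^ 2 * ρ ≤ 1) (hs₀ρ : 4 * (30 * (((P.d + 2) * P.L : ℕ) : ℝ) * (P.L : ℝ) ^ m * (2 * ((P.d : ℝ) * (3 * (P.L : ℝ) ^ (m + 1) - 1)) * a₀)) < ρ)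
    {θ₀ : ℝ} (hθ₀ : 2 * ((P.L : ℝ) * ((P.L : ℝ) ^ P.d)⁻¹) + (16 * (12 * (P.L : ℝ) * ρ) / ρ ^ 2 * (2 * (30 * (((P.d + 2) * P.L : ℕ) : ℝ) * (P.L : ℝ) ^ (J - 1) * (2 * ((P.d : ℝ) * (3 * (P.L : ℝ) ^ ((J - 1) + 1) - 1)) * a₀)))) ≤ θ₀)
    (βs : Site P m) (S : Finset (PBond P m)) (hS : ∀ c' ∈ S, c'.src = βs ∨ c'.tgt = βs)
    (w : PBond P m → Matrix (Fin 2) (Fin 2) ℂ) (hw : ∀ c', c' ∉ S → w c' = 0) {β' : ℝ} (hβ' : 0 ≤ β') (hwβ : ∀ c' ∈ S, ‖w c'‖ ≤ β') (c : PBond P (m + 1)) :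
    ‖(fderiv ℂ (fun (y : PBond P m → Matrix (Fin 2) (Fin 2) ℂ) (c : PBond P (m + 1)) =>
          mlog (((dbarCovU (emlIterU m (unitsField (toUField U₀))) (fun b => expUnit (y b) * emlIterU m (unitsField (toUField U₀)) b) c :
              (Matrix (Fin 2) (Fin 2) ℂ)ˣ) : Matrix (Fin 2) (Fin 2) ℂ) *
            (((emlAvgU (emlIterU m (unitsField (toUField U₀))) c)⁻¹ : (Matrix (Fin 2) (Fin 2) ℂ)ˣ) : Matrix (Fin 2) (Fin 2) ℂ))) 0 w) c‖ ≤ θ₀ * β' := by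
  have hL1 : (1 : ℝ) ≤ P.L := by exact_mod_cast P.L_pos
  have h := norm_fderiv_chartField_apply_le_of_endpoint_of_plaqSmall hm2 U₀ ha₀ hU hbud₀ hρ0 hbudget hs₀ρ βs S hS w hw hβ' hwβ c
  refine h.trans (mul_le_mul_of_nonneg_right ?_ hβ')
  have hmono := s0_mono (P := P) hL1 ha₀.le hm
  have hκ : 0 ≤ 16 * (12 * (P.L : ℝ) * ρ) / ρ ^ 2 := by positivity
  have : (16 * (12 * (P.L : ℝ) * ρ) / ρ ^ 2 * (2 * (30 * (((P.d + 2) * P.L : ℕ) : ℝ) * (P.L : ℝ) ^ m * (2 * ((P.d : ℝ) * (3 * (P.L : ℝ) ^ (m + 1) - 1)) * a₀)))) ≤ (16 * (12 * (P.L : ℝ) * ρ) / ρ ^ 2 * (2 * (30 * (((P.d + 2) * P.L : ℕ) : ℝ) * (P.L : ℝ) ^ (J - 1) * (2 * ((P.d : ℝ) * (3 * (P.L : ℝ) ^ ((J - 1) + 1) - 1)) * a₀)))) := mul_le_mul_of_nonneg_left (by linarith) hκ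
  linarith

end Summit.QuantumFields.YangMills.Theorems.Prop7CovKernelTowerLetters

end
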